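import Summits.BirchSwinnertonDyer.BirchSwinnertonDyer.Theorems.KolyvaginRoadThreeMethod2Basics
import Literature.NumberTheory.EllipticCurves.BSDRankZeroDensity
import Literature.NumberTheory.EllipticCurves.HeegnerPoints
import Literature.NumberTheory.EllipticCurves.SelmerCorankProofs
import Mathlib.LinearAlgebra.Dimension.Finrank
import Mathlib.LinearAlgebra.FiniteDimensional.Lemmas
import HarnessLib

/-!
# Route `KolyvaginRoadThree`, deciding crux `ZhangSharpFrameAtThreeHL` (item stmt-BirchSwinnertonDyer-19574):
# the eigen-decomposition of `τ`-stable pieces of `H¹(K, E[3])` and the rank identity at the bottom level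
# (cell `bsd-stepL`, seat `bsd-stepL-zhang3-p1` g5; `--supports stmt-BirchSwinnertonDyer-19574`, helper)

The stubs of the METHOD skeleton `Method2` speak of the `ZMod 3`-ranks of the two EIGEN-parts `SelQ W K c n true`,
`SelQ W K c n false` of the canonical level-raised Selmer spaces under complex conjugation `τ = conjAct W c 3`;
the tree's facts about `Sel₃(E/K)` (Gross 1991 §10, `finite_selmerGroup_holds`, `exists_natCard_selmerGroup_eq_pow`,
the `Koly.*` files) speak of the WHOLE group. This file supplies the bridge, `p = 3` being odd:

* `finrank_eq_eigen_add` — for an additive involution `τ` of `H¹(K, E[3])` and a `τ`-stable finite subgroup `T`,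
  `dim_𝔽₃ T = dim_𝔽₃ (T ∩ ker(τ − 1)) + dim_𝔽₃ (T ∩ ker(τ + 1))` (`x = −(x + τx) − (x − τx)` in characteristic 3);
* `finrank_selmer_eq_finrank_selQ_add` — at the bottom level: `dim Sel₃(E/K) = dim SelQ ∅ ⁺ + dim SelQ ∅ ⁻` for `K`
  imaginary quadratic and `c` an involution of `K` (the Selmer group is `Aut(K/ℚ)`-stable: tree
  `conjAct_mem_selmerGroup`).

HONEST FRAMING. Linear algebra over `ZMod 3` plus landed tree theorems; no named fact, no `sorry`, 0 defs.
PARTITION: O2@3 (B10) × A1 × crux 19574 — none (bookkeeping for the method skeleton; T7).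
[cite: WZhang2014, §5 (eigenspaces Sel^±)] [cite: GrossLMS1991, §5 (5.1) and §10]
-/

noncomputable section

open scoped Classical

namespace Summit.BirchSwinnertonDyer.Rank1Residual.X11b.Three.Koly.Method2

open WeierstrassCurve NumberField IsDedekindDomain
  Literature.NumberTheory.EllipticCurves Literature.NumberTheory.GaloisRepresentations Module

variable (W : WeierstrassCurve ℚ) (K : Type) [Field K] [NumberField K]

/-! ## Eigen-decomposition of a `τ`-stable finite piece of `H¹(K, E[3])` -/

/-- Every class of `H¹(K, E[3])` is killed by `3`. [folklore] -/
theorem three_smul_eq_zero (x : V3 W K) : (3 : ℤ) • x = 0 := by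
  have h := zsmul_galH1Torsion_eq_zero (W.baseChange K) ((3 ^ 1 : ℕ) : ℤ) x
  simpa using h

/-- **Eigen-decomposition in characteristic `3`.** Let `τ` be an additive involution of `H¹(K, E[3])` and `T` a finite
`τ`-stable subgroup. Then, as `ZMod 3`-spaces, `dim T = dim (ker(τ − 1) ⊓ T) + dim (ker(τ + 1) ⊓ T)`: the two
eigen-parts meet in `0` (`x = −x ⇒ 3x − 2x… = 0`) and span `T` (`x = −(x + τx) − (x − τx)`, using `3x = 0`).
[folklore] -/
theorem finrank_eq_eigen_add [Module (ZMod 3) (V3 W K)] (τ : V3 W K →+ V3 W K) (hτ : ∀ x, τ (τ x) = x)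
    (T : AddSubgroup (V3 W K)) (hT : ∀ x ∈ T, τ x ∈ T) [Finite T] :
    finrank (ZMod 3) (AddSubgroup.toZModSubmodule 3 T) =
      finrank (ZMod 3) (AddSubgroup.toZModSubmodule 3 ((τ - (1 : ℤ) • AddMonoidHom.id _).ker ⊓ T)) +
        finrank (ZMod 3) (AddSubgroup.toZModSubmodule 3 ((τ - (-1 : ℤ) • AddMonoidHom.id _).ker ⊓ T)) := by
  set A : Submodule (ZMod 3) (V3 W K) :=
    AddSubgroup.toZModSubmodule 3 ((τ - (1 : ℤ) • AddMonoidHom.id _).ker ⊓ T) with hA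
  set B : Submodule (ZMod 3) (V3 W K) :=
    AddSubgroup.toZModSubmodule 3 ((τ - (-1 : ℤ) • AddMonoidHom.id _).ker ⊓ T) with hB
  set T' : Submodule (ZMod 3) (V3 W K) := AddSubgroup.toZModSubmodule 3 T with hT'
  -- membership unfoldings
  have memA : ∀ x, x ∈ A ↔ τ x = x ∧ x ∈ T := fun x ↦ by
    change x ∈ ((AddSubgroup.toZModSubmodule 3 _ : Submodule (ZMod 3) (V3 W K)) : Set (V3 W K)) ↔ _
    rw [AddSubgroup.coe_toZModSubmodule]
    simp only [AddSubgroup.coe_inf, Set.mem_inter_iff, SetLike.mem_coe, AddMonoidHom.mem_ker,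
      AddMonoidHom.sub_apply, sub_eq_zero, one_smul]
    exact Iff.rfl
  have memB : ∀ x, x ∈ B ↔ τ x = -x ∧ x ∈ T := fun x ↦ by
    change x ∈ ((AddSubgroup.toZModSubmodule 3 _ : Submodule (ZMod 3) (V3 W K)) : Set (V3 W K)) ↔ _
    rw [AddSubgroup.coe_toZModSubmodule]
    simp only [AddSubgroup.coe_inf, Set.mem_inter_iff, SetLike.mem_coe, AddMonoidHom.mem_ker,
      AddMonoidHom.sub_apply, sub_eq_zero, neg_smul, one_smul]
    exact Iff.rfl
  have memT : ∀ x, x ∈ T' ↔ x ∈ T := fun x ↦ by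
    change x ∈ ((AddSubgroup.toZModSubmodule 3 _ : Submodule (ZMod 3) (V3 W K)) : Set (V3 W K)) ↔ _
    rw [AddSubgroup.coe_toZModSubmodule]
    rfl
  haveI : Finite T' := by
    refine Finite.of_injective (fun x : T' ↦ (⟨x.1, (memT x.1).mp x.2⟩ : T)) ?_
    intro x y h
    exact Subtype.ext (by simpa using congrArg Subtype.val h)
  haveI : Module.Finite (ZMod 3) T' := Module.Finite.of_finite
  have hAT : A ≤ T' := fun x hx ↦ (memT x).mpr ((memA x).mp hx).2
  have hBT : B ≤ T' := fun x hx ↦ (memT x).mpr ((memB x).mp hx).2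
  haveI : Module.Finite (ZMod 3) A := Submodule.finiteDimensional_of_le hAT
  haveI : Module.Finite (ZMod 3) B := Submodule.finiteDimensional_of_le hBT
  -- A ⊓ B = ⊥
  have hinf : A ⊓ B = ⊥ := by
    rw [eq_bot_iff]
    intro x hx
    obtain ⟨hxA, hxB⟩ := Submodule.mem_inf.mp hx
    have h1 := ((memA x).mp hxA).1
    have h2 := ((memB x).mp hxB).1
    rw [h1] at h2
    -- x = -x and 3 • x = 0 ⇒ x = 0
    have h3 := three_smul_eq_zero W K x
    have hx2 : (2 : ℤ) • x = 0 := by rw [two_zsmul]; nth_rw 2 [h2]; exact add_neg_cancel x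
    have : x = (3 : ℤ) • x - (2 : ℤ) • x := by abel
    rw [Submodule.mem_bot, this, h3, hx2, sub_zero]
  -- A ⊔ B = T'
  have hsup : A ⊔ B = T' := by
    refine le_antisymm (sup_le hAT hBT) fun x hx ↦ ?_
    have hxT : x ∈ T := (memT x).mp hx
    -- x = −(x + τ x) − (x − τ x)
    have hplus : -(x + τ x) ∈ A := by
      refine (memA _).mpr ⟨?_, T.neg_mem (T.add_mem hxT (hT x hxT))⟩
      rw [map_neg, map_add, hτ, add_comm]
    have hminus : -(x - τ x) ∈ B := by
      refine (memB _).mpr ⟨?_, T.neg_mem (T.sub_mem hxT (hT x hxT))⟩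
      rw [map_neg, map_sub, hτ, neg_neg, neg_sub]
    have hx3 := three_smul_eq_zero W K x
    have hdec : x = -(x + τ x) + -(x - τ x) := by
      have : -(x + τ x) + -(x - τ x) = x - (3 : ℤ) • x := by
        simp only [neg_add, neg_sub]
        have h3 : (3 : ℤ) • x = x + x + x := by
          rw [show (3 : ℤ) = 1 + 1 + 1 by norm_num, add_zsmul, add_zsmul, one_zsmul]
        rw [h3]
        abel
      rw [this, hx3, sub_zero]
    rw [hdec]
    exact Submodule.add_mem_sup hplus hminus
  have h := Submodule.finrank_sup_add_finrank_inf_eq A B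
  rw [hinf, finrank_bot, add_zero, hsup] at h
  exact h

/-! ## The bottom level: `dim Sel₃(E/K) = dim Sel_∅⁺ + dim Sel_∅⁻` -/

variable [W.IsGloballyMinimal]

/-- `SelQ W K c ∅ μ` is the `ZMod 3`-span-free image of `ker(τ − sgn μ) ⊓ Sel₃(E/K)`. [folklore] -/
theorem selQ_empty_eq [Module (ZMod 3) (V3 W K)] (c : K ≃ₐ[ℚ] K) (μ : Bool) :
    SelQ W K c ∅ μ = AddSubgroup.toZModSubmodule 3
      ((conjAct W c ((3 ^ 1 : ℕ) : ℤ) - sgn μ • AddMonoidHom.id (V3 W K)).ker ⊓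
        selmerGroup (W.baseChange K) ((3 ^ 1 : ℕ) : ℤ)) := by
  unfold SelQ
  rw [Finset.image_empty, levelSelmerSubgroup_empty]

/-- **`dim_𝔽₃ Sel₃(E/K) = dim SelQ ∅ ⁺ + dim SelQ ∅ ⁻`** for `K` imaginary quadratic and `c` an involution of `K`
(e.g. complex conjugation): the Selmer group is `Aut(K/ℚ)`-stable (tree `conjAct_mem_selmerGroup`), finite (tree
`finite_selmerGroup_holds`), and decomposes into its `τ`-eigenspaces since `3` is odd. This is the dictionary
between the stubs' eigen-ranks at level `∅` and every tree statement about `#Sel₃(E/K)`.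
[cite: GrossLMS1991, §5 (5.1) and §10] -/
theorem finrank_selmer_eq_finrank_selQ_add [W.IsElliptic] [Module (ZMod 3) (V3 W K)] (hK : IsImaginaryQuadratic K)
    (c : K ≃ₐ[ℚ] K) (hc : c * c = 1) :
    finrank (ZMod 3) (AddSubgroup.toZModSubmodule 3 (selmerGroup (W.baseChange K) ((3 ^ 1 : ℕ) : ℤ))) =
      finrank (ZMod 3) (SelQ W K c ∅ true) + finrank (ZMod 3) (SelQ W K c ∅ false) := by
  have hN3 : (((3 ^ 1 : ℕ) : ℤ)) ≠ 0 := by norm_num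
  haveI : Finite (selmerGroup (W.baseChange K) ((3 ^ 1 : ℕ) : ℤ)) :=
    (W.baseChange K).finite_selmerGroup_holds hN3
  have hstab : ∀ x ∈ selmerGroup (W.baseChange K) ((3 ^ 1 : ℕ) : ℤ),
      conjAct W c ((3 ^ 1 : ℕ) : ℤ) x ∈ selmerGroup (W.baseChange K) ((3 ^ 1 : ℕ) : ℤ) :=
    fun x hx ↦ conjAct_mem_selmerGroup W (fun w ↦ hK.2.isComplex w) c _ hx
  have h := finrank_eq_eigen_add W K (conjAct W c ((3 ^ 1 : ℕ) : ℤ))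
    (conjAct_conjAct_of_mul_self W hc ((3 ^ 1 : ℕ) : ℤ)) _ hstab
  rw [selQ_empty_eq, selQ_empty_eq]
  have ht : sgn true = 1 := rfl
  have hf : sgn false = -1 := rfl
  rw [ht, hf]
  exact h


/-- **`#Sel₃(E/K) = 3 ^ (dim SelQ ∅ ⁺ + dim SelQ ∅ ⁻)`** — the cardinality form of `finrank_selmer_eq_finrank_selQ_add`,
matching the tree's `Nat.card`-currency for Selmer groups (e.g. `exists_natCard_selmerGroup_eq_pow`, the Koly.*
certificate files): (A5)'s hypothesis «canonical total rank one at level ∅» reads `#Sel₃(E/K) = 3`.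
[cite: GrossLMS1991, §10 (Prop. 2.3: Sel(E/K)_p cyclic of order p)] -/
theorem natCard_selmer_eq_pow_finrank_selQ_add [W.IsElliptic] [Module (ZMod 3) (V3 W K)]
    (hK : IsImaginaryQuadratic K) (c : K ≃ₐ[ℚ] K) (hc : c * c = 1) :
    Nat.card (selmerGroup (W.baseChange K) ((3 ^ 1 : ℕ) : ℤ)) =
      3 ^ (finrank (ZMod 3) (SelQ W K c ∅ true) + finrank (ZMod 3) (SelQ W K c ∅ false)) := by
  rw [← finrank_selmer_eq_finrank_selQ_add W K hK c hc]
  have hN3 : (((3 ^ 1 : ℕ) : ℤ)) ≠ 0 := by norm_num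
  haveI : Finite (selmerGroup (W.baseChange K) ((3 ^ 1 : ℕ) : ℤ)) :=
    (W.baseChange K).finite_selmerGroup_holds hN3
  haveI : Finite (AddSubgroup.toZModSubmodule 3 (selmerGroup (W.baseChange K) ((3 ^ 1 : ℕ) : ℤ))) :=
    Finite.of_equiv _ (Equiv.setCongr (AddSubgroup.coe_toZModSubmodule 3 _).symm)
  haveI : Fact (Nat.Prime 3) := ⟨Nat.prime_three⟩
  rw [pow_finrank_eq_natCard]
  exact Nat.card_congr (Equiv.setCongr (AddSubgroup.coe_toZModSubmodule 3 _)).symm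

/-- **(A5)'s hypothesis at level `∅` in `Nat.card` currency**: `dim SelQ ∅ ⁺ + dim SelQ ∅ ⁻ = 1 ↔ #Sel₃(E/K) = 3`.
[cite: GrossLMS1991, §10 (Prop. 2.3)] -/
theorem finrank_selQ_empty_add_eq_one_iff [W.IsElliptic] [Module (ZMod 3) (V3 W K)]
    (hK : IsImaginaryQuadratic K) (c : K ≃ₐ[ℚ] K) (hc : c * c = 1) :
    finrank (ZMod 3) (SelQ W K c ∅ true) + finrank (ZMod 3) (SelQ W K c ∅ false) = 1 ↔
      Nat.card (selmerGroup (W.baseChange K) ((3 ^ 1 : ℕ) : ℤ)) = 3 := by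
  rw [natCard_selmer_eq_pow_finrank_selQ_add W K hK c hc]
  constructor
  · intro h
    rw [h, pow_one]
  · intro h
    have h' : 3 ^ (finrank (ZMod 3) (SelQ W K c ∅ true) + finrank (ZMod 3) (SelQ W K c ∅ false)) = 3 ^ 1 := by
      rw [h, pow_one]
    exact Nat.pow_right_injective (by norm_num : 2 ≤ 3) h'

end Summit.BirchSwinnertonDyer.Rank1Residual.X11b.Three.Koly.Method2

end
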